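import Literature.NumberTheory.ModularForms.PoincareSeriesWeightTwoHeckeContinuous
import Literature.NumberTheory.ModularForms.PoincareSeriesWeightTwoHeckeUnfoldingPointwise
import Literature.NumberTheory.ModularForms.PoincareSeriesWeightTwoL2OfDominated
import Literature.NumberTheory.Automorphic.RankinSelbergUniformBoundSL2
import Literature.NumberTheory.Automorphic.IncompleteEisensteinSeries
import Literature.NumberTheory.EllipticCurves.HeckeOperatorsPeterssonProofs
import HarnessLib

/-!
# The Hecke-regularised weight-2 Poincaré series is square-integrable on `Γ₀(N)\ℍ` for every `s > 0`

Topic `Literature/NumberTheory/ModularForms` (namespace `Literature.NumberTheory.ModularForms.PoincareWeightTwo`,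
continuing `PoincareSeriesWeightTwoHecke.lean`). THEOREMS ONLY; no definition, no named fact.
For `m ≥ 1`, `s > 0` and EVERY level `N`, the function `E_s(z) = yˢ P_m(z, s)` (Iwaniec–Kowalski
§14.1 (14.4) with Hecke's factor, §3.2) satisfies `sup_{w ∈ ℍ} (Im w)^{1+s} |P_m(w, s)| < ∞`, hence
`PeterssonSqIntegrable N 2 E_s` — conjunct (b) of `HeckeL2` and item (ii) of `HeckeDomination` of the
I1 fact skeleton `Summits/Parity/GeneralizedHardyLittlewood/Cruxes/PeterssonBoundPrinted/Lines/poincare_hecke.lean`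
(crux item stmt-Parity-20404), with NO Fourier expansion and no cusp analysis:

* termwise, `(Im w)^{1+s} |j_v(w)|^{−2−2s} e^{−2πm Im γ_v w} = φ_s(Im γ_v w)` with
  `φ_s(u) = u^{1+s} e^{−2πmu}` (`rpow_im_mul_norm_poincareTerm_eq`), so that
  `(Im w)^{1+s} |P_m(w,s)| ≤ ½ E(w|φ_s)`, the INCOMPLETE EISENSTEIN SERIES of `SL₂(ℤ)` with weight
  `φ_s` (Iwaniec, *Spectral Methods*, (3.10); the tree's `incEisG`, summed over all coprime rows, a
  superset of `Row N`) — `rpow_im_mul_norm_poincareHecke_le_incEisG`;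
* `E(·|φ_s)` is `SL₂(ℤ)`-invariant (`incEisG_smul`), every point is a translate of a point of the
  standard fundamental domain `𝒟` (`ModularGroup.exists_smul_mem_fd`), and on `𝒟` the rows of height
  `≤ 1` contribute a bounded amount (`tsum_indicator_rpow_im_le`, exponent `1 + min(s,1) ∈ (1,2]`)
  while at most two rows have height `> 1` (`tsum_indicator_one_lt_im_le_two`), each contributing at
  most `sup φ_s ≤ (2(1+s)/(4πe m))^{1+s}` (`rpow_mul_exp_neg_half_mul_le`) — `incEisG_le_of_mem_fd`,
  `exists_bound_rpow_im_mul_norm_poincareHecke`;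
* the square-integrand `Σ_q |E_s(q⁻¹τ)|² (Im q⁻¹τ)² = Σ_q ((Im)^{1+s}|P_m|)²(q⁻¹τ)` is then bounded by
  a constant on `𝒟`, which has finite volume (`volume_fd_lt_top`): `peterssonSqIntegrable_of_le`
  (continuity: `continuous_rpow_im_mul_poincareHecke`) — `peterssonSqIntegrable_rpow_im_mul_poincareHecke`.

## References

* [IwaniecKowalski2004] H. Iwaniec, E. Kowalski, *Analytic Number Theory*, AMS Colloq. Publ. 53,
  §14.1 (14.4)–(14.5), (14.11); §3.2 (Hecke's trick).
* [Iwaniec2002] H. Iwaniec, *Spectral Methods of Automorphic Forms*, 2nd ed., GSM 53, §3.2 (3.10)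
  (incomplete Eisenstein series), (3.20) (`E(z,s) ≪ y^σ` on `𝒟`).

## Mathlib / tree search

Tree: `norm_poincareTerm_eq`, `summable_norm_poincareTerm`, `hasSum_poincareHecke`
(`PoincareSeriesWeightTwoHeckeConvergence`), `im_rowMatrix_smul` (`…HeckeUnfoldingPointwise`),
`continuous_rpow_im_mul_poincareHecke` (`…HeckeContinuous`), `peterssonSqIntegrable_of_le`
(`…L2OfDominated`), `incEisG`, `incEisG_smul`, `im_rowRep_smul_eq` (`Automorphic/IncompleteEisensteinSeries`),
`tsum_indicator_rpow_im_le`, `tsum_indicator_one_lt_im_le_two`, `rpow_mul_exp_neg_half_mul_le`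
(`Automorphic/RankinSelbergUniformBoundSL2`), `summable_rpow_im_div_normSq`
(`EllipticCurves/Gamma0EisensteinHeckeIdentity`), `volume_fd_lt_top` (`EllipticCurves/HeckeOperatorsPeterssonProofs`);
Mathlib `ModularGroup.exists_smul_mem_fd`, `EisensteinSeries.mem_gammaSet_one`.
-/

noncomputable section

open scoped MatrixGroups Real ENNReal
open CongruenceSubgroup Complex MeasureTheory
open UpperHalfPlane hiding I
open EisensteinSeries (gammaSet mem_gammaSet_one)
open Literature.NumberTheory.Automorphic (incEisG incEisG_smul im_rowRep_smul_eq rowRep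
  tsum_indicator_rpow_im_le tsum_indicator_one_lt_im_le_two rpow_mul_exp_neg_half_mul_le)

namespace Literature.NumberTheory.ModularForms.PoincareWeightTwo

variable {N : ℕ}

/-! ### The termwise identity and the comparison with an incomplete Eisenstein series -/

/-- **Termwise:** `(Im w)^{1+s} · |(cw+d)⁻²|cw+d|^{−2s} e(mγ_v w)| = φ_s(Im γ_v w)` with
`φ_s(u) = u^{1+s} e^{−2πmu}` (`Im γ_v w = Im w/|cw+d|²`). [cite: IwaniecKowalski2004, §14.1 (14.4)–(14.5)] -/
theorem rpow_im_mul_norm_poincareTerm_eq (m : ℕ) (s : ℝ) (v : Row N) (w : ℍ) :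
    w.im ^ (1 + s) * ‖poincareTerm N m s v w‖ =
      (rowMatrix v.1 v.2.1 • w).im ^ (1 + s) *
        Real.exp (-(2 * π * m * (rowMatrix v.1 v.2.1 • w).im)) := by
  rw [norm_poincareTerm_eq, im_rowMatrix_smul, ← mul_assoc]
  congr 1
  have hj : 0 < ‖rowDenom v.1 w‖ := norm_rowDenom_pos v.1 v.2.1 w
  have hy : 0 ≤ w.im := w.im_pos.le
  rw [Real.div_rpow hy (by positivity), Real.rpow_neg hj.le, div_eq_mul_inv]
  congr 2
  rw [show ‖rowDenom v.1 w‖ ^ 2 = ‖rowDenom v.1 w‖ ^ (2 : ℝ) by norm_cast, ← Real.rpow_mul hj.le]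
  congr 1
  ring

/-- The rows `Row N` of `Γ_∞\Γ₀(N)` inside the coprime rows of `SL₂(ℤ)` (Mathlib's `gammaSet 1 1 0`).
[cite: IwaniecKowalski2004, §14.1 (14.4)] -/
theorem injective_row_to_gammaSet :
    Function.Injective (fun v : Row N ↦ (⟨v.1, (mem_gammaSet_one v.1).mpr v.2.1⟩ : gammaSet 1 1 0)) := by
  intro v v' h
  simp only [Subtype.mk.injEq] at h
  exact Subtype.ext h

/-- `Im (rowRep v • w) = Im w / |cw + d|²` in the `rowDenom` currency, for a coprime row `v = (c,d)`.
[cite: Iwaniec2002, §3.2 (3.10)] -/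
theorem im_rowRep_smul_eq_div_norm_rowDenom_sq (w : ℍ) (v : gammaSet 1 1 0) :
    (rowRep v • w).im = w.im / ‖rowDenom (v : Fin 2 → ℤ) w‖ ^ 2 := by
  rw [im_rowRep_smul_eq, Complex.normSq_eq_norm_sq]
  rfl

/-- The weight `φ_s(Im γ_v w)` is summable over ALL coprime rows for `s > 0` (`φ_s(u) ≤ u^{1+s}` and
the Epstein zeta function converges at `1 + s > 1`). [cite: Iwaniec2002, §3.2 (3.10)–(3.11)] -/
theorem summable_weight_im_rowRep_smul (m : ℕ) {s : ℝ} (hs : 0 < s) (w : ℍ) :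
    Summable fun v : gammaSet 1 1 0 ↦
      (rowRep v • w).im ^ (1 + s) * Real.exp (-(2 * π * m * (rowRep v • w).im)) := by
  have hsum : Summable fun v : gammaSet 1 1 0 ↦ (rowRep v • w).im ^ (1 + s) := by
    have h := (Literature.NumberTheory.EllipticCurves.ModularForms.summable_rpow_im_div_normSq w
      (by linarith : 1 < 1 + s)).subtype (gammaSet 1 1 0)
    refine h.congr fun v ↦ ?_
    simp only [Function.comp_apply]
    rw [im_rowRep_smul_eq]
  refine hsum.of_nonneg_of_le (fun v ↦ mul_nonneg (Real.rpow_nonneg (UpperHalfPlane.im_pos _).le _)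
    (Real.exp_nonneg _)) fun v ↦ ?_
  have h0 : 0 ≤ (rowRep v • w).im ^ (1 + s) := Real.rpow_nonneg (UpperHalfPlane.im_pos _).le _
  have h1 : Real.exp (-(2 * π * m * (rowRep v • w).im)) ≤ 1 := by
    rw [Real.exp_le_one_iff, neg_nonpos]
    have := (rowRep v • w).im_pos
    positivity
  nlinarith

/-- **Comparison with the incomplete Eisenstein series of `SL₂(ℤ)`:** for `s > 0`,
`(Im w)^{1+s} |P_m(w, s)| ≤ ½ E(w|φ_s)`, `E(w|φ_s) = Σ_{(c,d)=1} φ_s(Im γ_{c,d} w)` (all coprime rows;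
the rows of `Γ₀(N)` are a sub-family and the terms are non-negative). [cite: IwaniecKowalski2004, §14.1 (14.5)] -/
theorem rpow_im_mul_norm_poincareHecke_le_incEisG (m : ℕ) {s : ℝ} (hs : 0 < s) (w : ℍ) :
    w.im ^ (1 + s) * ‖poincareHecke N m s w‖ ≤
      1 / 2 * incEisG (fun u : ℝ ↦ u ^ (1 + s) * Real.exp (-(2 * π * m * u))) w := by
  have hy : 0 ≤ w.im ^ (1 + s) := Real.rpow_nonneg w.im_pos.le _
  -- `|P| ≤ Σ ½|term|`
  have hsn : Summable fun v : Row N ↦ ‖(1 / 2 : ℂ) * poincareTerm N m s v w‖ := by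
    simpa [norm_mul] using (summable_norm_poincareTerm m hs w).mul_left (1 / 2 : ℝ)
  have h1 : ‖poincareHecke N m s w‖ ≤ ∑' v : Row N, ‖(1 / 2 : ℂ) * poincareTerm N m s v w‖ := by
    rw [← (hasSum_poincareHecke m hs w).tsum_eq]
    exact norm_tsum_le_tsum_norm hsn
  -- the termwise identity
  have h2 : w.im ^ (1 + s) * ∑' v : Row N, ‖(1 / 2 : ℂ) * poincareTerm N m s v w‖ =
      1 / 2 * ∑' v : Row N, (rowMatrix v.1 v.2.1 • w).im ^ (1 + s) *
        Real.exp (-(2 * π * m * (rowMatrix v.1 v.2.1 • w).im)) := by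
    rw [← tsum_mul_left, ← tsum_mul_left]
    refine tsum_congr fun v ↦ ?_
    rw [norm_mul, show ‖(1 / 2 : ℂ)‖ = 1 / 2 by norm_num, ← rpow_im_mul_norm_poincareTerm_eq]
    ring
  -- the sub-family comparison
  have h3 : ∑' v : Row N, (rowMatrix v.1 v.2.1 • w).im ^ (1 + s) *
        Real.exp (-(2 * π * m * (rowMatrix v.1 v.2.1 • w).im)) ≤
      incEisG (fun u : ℝ ↦ u ^ (1 + s) * Real.exp (-(2 * π * m * u))) w := by
    unfold incEisG
    have hg : Summable fun v : Row N ↦ (rowMatrix v.1 v.2.1 • w).im ^ (1 + s) *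
        Real.exp (-(2 * π * m * (rowMatrix v.1 v.2.1 • w).im)) := by
      have := (summable_norm_poincareTerm (N := N) m hs w).mul_left (w.im ^ (1 + s))
      refine this.congr fun v ↦ ?_
      exact rpow_im_mul_norm_poincareTerm_eq m s v w
    refine Summable.tsum_le_tsum_of_inj _ injective_row_to_gammaSet (fun c _ ↦
      mul_nonneg (Real.rpow_nonneg (UpperHalfPlane.im_pos _).le _) (Real.exp_nonneg _))
      (fun v ↦ le_of_eq ?_) hg (summable_weight_im_rowRep_smul m hs w)
    simp only
    rw [im_rowRep_smul_eq_div_norm_rowDenom_sq, im_rowMatrix_smul]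
  calc w.im ^ (1 + s) * ‖poincareHecke N m s w‖
      ≤ w.im ^ (1 + s) * ∑' v : Row N, ‖(1 / 2 : ℂ) * poincareTerm N m s v w‖ := by gcongr
    _ = _ := h2
    _ ≤ _ := by gcongr

/-! ### The incomplete Eisenstein series with weight `φ_s` is bounded on `𝒟`, hence on `ℍ` -/

/-- **`E(τ|φ_s)` is bounded on the standard fundamental domain** (`m ≥ 1`, `s > 0`): the rows of
height `≤ 1` give at most `2 + 32 + 4π(1 + 1/(2 min(s,1)))` (exponent `1 + min(s,1) ∈ (1, 2]`), the
at most two rows of height `> 1` give at most `sup φ_s ≤ (2(1+s)/(e·4πm))^{1+s}` each.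
[cite: Iwaniec2002, §3.2 (3.10) and (3.20)] -/
theorem incEisG_le_of_mem_fd {m : ℕ} (hm : 1 ≤ m) {s : ℝ} (hs : 0 < s) {τ : ℍ}
    (hτ : τ ∈ ModularGroup.fd) :
    incEisG (fun u : ℝ ↦ u ^ (1 + s) * Real.exp (-(2 * π * m * u))) τ ≤
      (2 + ENNReal.ofReal (32 + 4 * π * (1 + 1 / (2 * min s 1))) +
        ENNReal.ofReal ((2 * (1 + s) / (Real.exp 1 * (4 * π * m))) ^ (1 + s)) * 2).toReal := by
  set φ : ℝ → ℝ := fun u : ℝ ↦ u ^ (1 + s) * Real.exp (-(2 * π * m * u)) with hφ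
  set s' : ℝ := 1 + min s 1 with hs'
  set C₀ : ℝ := (2 * (1 + s) / (Real.exp 1 * (4 * π * m))) ^ (1 + s) with hC₀
  have hs'1 : 1 < s' := by have := lt_min hs one_pos; linarith
  have hs'2 : s' ≤ 2 := by have := min_le_right s 1; linarith
  have hm0 : (0 : ℝ) < m := by exact_mod_cast hm
  have hφ0 : ∀ u : ℝ, 0 ≤ u → 0 ≤ φ u := fun u hu ↦
    mul_nonneg (Real.rpow_nonneg hu _) (Real.exp_nonneg _)
  -- `sup φ ≤ C₀`
  have hφC : ∀ u : ℝ, 0 < u → φ u ≤ C₀ := by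
    intro u hu
    have h := rpow_mul_exp_neg_half_mul_le (s := 1 + s) (a := 4 * π * m) (y := u)
      (by linarith) (by positivity) hu
    have he : Real.exp (-(4 * π * m / 2 * u)) = Real.exp (-(2 * π * m * u)) := by
      congr 1; ring
    rw [he] at h
    exact h
  -- `φ(u) ≤ u^{s'}` for `u ≤ 1`
  have hφ1 : ∀ u : ℝ, 0 < u → u ≤ 1 → φ u ≤ u ^ s' := by
    intro u hu hu1
    have h1 : Real.exp (-(2 * π * m * u)) ≤ 1 := by
      rw [Real.exp_le_one_iff, neg_nonpos]; positivity
    have h2 : u ^ (1 + s) ≤ u ^ s' :=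
      Real.rpow_le_rpow_of_exponent_ge hu hu1 (by have := min_le_left s 1; linarith)
    calc φ u = u ^ (1 + s) * Real.exp (-(2 * π * m * u)) := rfl
      _ ≤ u ^ (1 + s) * 1 := by gcongr
      _ ≤ u ^ s' := by rw [mul_one]; exact h2
  -- pointwise: `ofReal (φ (Im z)) ≤ 𝟙[Im z ≤ 1] ofReal((Im z)^{s'}) + ofReal C₀ · 𝟙[1 < Im z]`
  have hpt : ∀ z : ℍ, ENNReal.ofReal (φ z.im) ≤
      {z : ℍ | z.im ≤ 1}.indicator (fun z ↦ ENNReal.ofReal (z.im ^ s')) z +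
        ENNReal.ofReal C₀ * {z : ℍ | 1 < z.im}.indicator (fun _ ↦ (1 : ℝ≥0∞)) z := by
    intro z
    by_cases hz : z.im ≤ 1
    · have hz' : ¬ (1 < z.im) := not_lt.mpr hz
      rw [Set.indicator_of_mem (show z ∈ {z : ℍ | z.im ≤ 1} from hz),
        Set.indicator_of_notMem (show z ∉ {z : ℍ | 1 < z.im} from hz'), mul_zero, add_zero]
      exact ENNReal.ofReal_le_ofReal (hφ1 z.im z.im_pos hz)
    · have hz' : 1 < z.im := not_le.mp hz
      rw [Set.indicator_of_notMem (show z ∉ {z : ℍ | z.im ≤ 1} from hz),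
        Set.indicator_of_mem (show z ∈ {z : ℍ | 1 < z.im} from hz'), mul_one, zero_add]
      exact ENNReal.ofReal_le_ofReal (hφC z.im z.im_pos)
  -- sum over the coprime rows, in `ℝ≥0∞`
  have hsum := summable_weight_im_rowRep_smul m hs τ
  have hK : ENNReal.ofReal (incEisG φ τ) ≤
      2 + ENNReal.ofReal (32 + 4 * π * (1 + 1 / (2 * min s 1))) + ENNReal.ofReal C₀ * 2 := by
    unfold incEisG
    rw [ENNReal.ofReal_tsum_of_nonneg (fun v ↦ hφ0 _ (UpperHalfPlane.im_pos _).le) hsum]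
    calc ∑' v : gammaSet 1 1 0, ENNReal.ofReal (φ (rowRep v • τ).im)
        ≤ ∑' v : gammaSet 1 1 0,
            ({z : ℍ | z.im ≤ 1}.indicator (fun z ↦ ENNReal.ofReal (z.im ^ s')) (rowRep v • τ) +
              ENNReal.ofReal C₀ * {z : ℍ | 1 < z.im}.indicator (fun _ ↦ (1 : ℝ≥0∞)) (rowRep v • τ)) :=
          ENNReal.tsum_le_tsum fun v ↦ hpt _
      _ = (∑' v : gammaSet 1 1 0,
            {z : ℍ | z.im ≤ 1}.indicator (fun z ↦ ENNReal.ofReal (z.im ^ s')) (rowRep v • τ)) +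
            ENNReal.ofReal C₀ * ∑' v : gammaSet 1 1 0,
              {z : ℍ | 1 < z.im}.indicator (fun _ ↦ (1 : ℝ≥0∞)) (rowRep v • τ) := by
          rw [ENNReal.tsum_add, ENNReal.tsum_mul_left]
      _ ≤ (2 + ENNReal.ofReal (32 + 4 * π * (1 + 1 / (2 * (s' - 1))))) + ENNReal.ofReal C₀ * 2 := by
          gcongr
          · exact tsum_indicator_rpow_im_le hτ hs'1 hs'2
          · exact tsum_indicator_one_lt_im_le_two hτ
      _ = 2 + ENNReal.ofReal (32 + 4 * π * (1 + 1 / (2 * min s 1))) + ENNReal.ofReal C₀ * 2 := by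
          rw [hs']; ring_nf
  have hne : (2 + ENNReal.ofReal (32 + 4 * π * (1 + 1 / (2 * min s 1))) +
      ENNReal.ofReal C₀ * 2) ≠ ⊤ := by
    refine ENNReal.add_ne_top.mpr ⟨ENNReal.add_ne_top.mpr ⟨by norm_num, ENNReal.ofReal_ne_top⟩, ?_⟩
    exact ENNReal.mul_ne_top ENNReal.ofReal_ne_top (by norm_num)
  exact (ENNReal.ofReal_le_iff_le_toReal hne).mp hK

/-- **`sup_{w ∈ ℍ} (Im w)^{1+s} |P_m(w, s)| < ∞`** for `m ≥ 1`, `s > 0`, at every level `N`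
(comparison with `E(·|φ_s)`, its `SL₂(ℤ)`-invariance, and the bound on `𝒟`).
[cite: IwaniecKowalski2004, §14.1 (14.5)] -/
theorem exists_bound_rpow_im_mul_norm_poincareHecke {m : ℕ} (hm : 1 ≤ m) {s : ℝ} (hs : 0 < s) :
    ∃ C : ℝ, 0 ≤ C ∧ ∀ w : ℍ, w.im ^ (1 + s) * ‖poincareHecke N m s w‖ ≤ C := by
  set K : ℝ := (2 + ENNReal.ofReal (32 + 4 * π * (1 + 1 / (2 * min s 1))) +
    ENNReal.ofReal ((2 * (1 + s) / (Real.exp 1 * (4 * π * m))) ^ (1 + s)) * 2).toReal with hK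
  refine ⟨1 / 2 * K, by positivity, fun w ↦ ?_⟩
  obtain ⟨g, hg⟩ := ModularGroup.exists_smul_mem_fd w
  calc w.im ^ (1 + s) * ‖poincareHecke N m s w‖
      ≤ 1 / 2 * incEisG (fun u : ℝ ↦ u ^ (1 + s) * Real.exp (-(2 * π * m * u))) w :=
        rpow_im_mul_norm_poincareHecke_le_incEisG m hs w
    _ = 1 / 2 * incEisG (fun u : ℝ ↦ u ^ (1 + s) * Real.exp (-(2 * π * m * u))) (g • w) := by
        rw [incEisG_smul]
    _ ≤ 1 / 2 * K := by
        gcongr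
        exact incEisG_le_of_mem_fd hm hs hg

/-! ### Square-integrability -/

/-- The Petersson square-integrand of `E_s = yˢP_m(·,s)` at a point: `|E_s(w)|² (Im w)² =
((Im w)^{1+s} |P_m(w,s)|)²`. [cite: IwaniecKowalski2004, (14.11)] -/
theorem norm_rpow_im_mul_poincareHecke_sq_mul (m : ℕ) (s : ℝ) (w : ℍ) :
    ‖((w.im ^ s : ℝ) : ℂ) * poincareHecke N m s w‖ ^ 2 * (w.im) ^ (2 : ℤ) =
      (w.im ^ (1 + s) * ‖poincareHecke N m s w‖) ^ 2 := by
  have hy : 0 < w.im := w.im_pos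
  rw [norm_mul, Complex.norm_real, Real.norm_of_nonneg (Real.rpow_nonneg hy.le _), zpow_ofNat,
    Real.rpow_add hy, Real.rpow_one]
  ring

/-- **`E_s = yˢ P_m(·, s)` is square-integrable on `Γ₀(N)\ℍ` for every `s > 0`** (`m ≥ 1`, every
level `N`): conjunct (b) of `HeckeL2` / item (ii) of `HeckeDomination` of the I1 skeleton
`poincare_hecke`, verbatim. The square-integrand is bounded by a constant on `𝒟` (finite volume).
[cite: IwaniecKowalski2004, §14.1 (14.5) and (14.11)] -/
theorem peterssonSqIntegrable_rpow_im_mul_poincareHecke :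
    ∀ (N : ℕ) [NeZero N] (m : ℕ), 1 ≤ m → ∀ s : ℝ, 0 < s →
      PeterssonSqIntegrable N 2 (fun z : ℍ ↦ ((z.im ^ s : ℝ) : ℂ) * poincareHecke N m s z) := by
  intro N _ m hm s hs
  letI := Fintype.ofFinite (𝒮ℒ ⧸ (Gamma0 N : Subgroup (GL (Fin 2) ℝ)).subgroupOf 𝒮ℒ)
  obtain ⟨C, hC0, hC⟩ := exists_bound_rpow_im_mul_norm_poincareHecke (N := N) hm hs
  refine peterssonSqIntegrable_of_le (continuous_rpow_im_mul_poincareHecke m hs)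
    (G := fun _ ↦ (Fintype.card (𝒮ℒ ⧸ (Gamma0 N : Subgroup (GL (Fin 2) ℝ)).subgroupOf 𝒮ℒ) : ℝ) * C ^ 2)
    ?_ fun τ _ ↦ ?_
  · exact integrableOn_const
      (Literature.NumberTheory.EllipticCurves.ModularForms.volume_fd_lt_top).ne
  · calc ∑ q : 𝒮ℒ ⧸ (Gamma0 N : Subgroup (GL (Fin 2) ℝ)).subgroupOf 𝒮ℒ,
          ‖(fun z : ℍ ↦ ((z.im ^ s : ℝ) : ℂ) * poincareHecke N m s z)
              (((q.out : 𝒮ℒ) : GL (Fin 2) ℝ)⁻¹ • τ)‖ ^ 2 *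
            ((((q.out : 𝒮ℒ) : GL (Fin 2) ℝ)⁻¹ • τ).im) ^ (2 : ℤ)
        ≤ ∑ _q : 𝒮ℒ ⧸ (Gamma0 N : Subgroup (GL (Fin 2) ℝ)).subgroupOf 𝒮ℒ, C ^ 2 := by
          refine Finset.sum_le_sum fun q _ ↦ ?_
          simp only
          rw [norm_rpow_im_mul_poincareHecke_sq_mul]
          exact pow_le_pow_left₀ (mul_nonneg (Real.rpow_nonneg (UpperHalfPlane.im_pos _).le _)
            (norm_nonneg _)) (hC _) 2
      _ = (Fintype.card (𝒮ℒ ⧸ (Gamma0 N : Subgroup (GL (Fin 2) ℝ)).subgroupOf 𝒮ℒ) : ℝ) * C ^ 2 := by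
          rw [Finset.sum_const, Finset.card_univ, nsmul_eq_mul]

end Literature.NumberTheory.ModularForms.PoincareWeightTwo

end
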